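import Mathlib
import Summits.Ventures.PercRepro2.Defs
import Summits.Ventures.PercRepro2.Harris
import Summits.Ventures.PercRepro2.TReduction
import Summits.Ventures.PercRepro2.TReductionBase

/-!
# Enumerating the antipodal base cases edge by edge (mine-a g50)

A *pinning pattern* `s : Fin n → Fin 3` declares every edge closed (`0`), open (`1`) or free
(`2`).  The antipodal base case of `TReduction` at the pattern — the sum over the configurations
`σ` supported on the free edges of `F c_σ c_σ̄`, where `c_σ` carries `σ` on the free edges and the
pinned state elsewhere and `c_σ̄` is its antipode on the free edges — is computed by the nested
recursion `kbGen` (one edge at a time, two branches at a free edge, one at a pinned edge), so that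
a kernel evaluation costs `2^{#free}` leaves and nothing else.  `kbGen_eq_sum` identifies it with
the filtered sum over all configurations, and `kform_eq_kbGen` with `TReduction.kform` at a base
case (through `TReductionBase.kform_eq_antipodal_sum`) for events decided by Boolean predicates.
No instance, no notation.
-/

namespace Summit.Ventures.PercRepro2

namespace THBaseEnum

open Finset TReduction

section Enum

/-- The states of the two copies at an edge of pinning state `0` (both closed), `1` (both open)
or `2` (free: antipodal). -/
def choices : Fin 3 → List (Bool × Bool)
  | 0 => [(false, false)]
  | 1 => [(true, true)]
  | 2 => [(false, true), (true, false)]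

/-- The nested antipodal sum over the free edges of the pattern `s`, the leaf function `F`
receiving the two copies. -/
def kbGen : (n : ℕ) → (Fin n → Fin 3) → ((Fin n → Bool) → (Fin n → Bool) → ℤ) → ℤ
  | 0, _, F => F finZeroElim finZeroElim
  | n + 1, s, F => ((choices (s 0)).map fun c =>
      kbGen n (Fin.tail s) fun ω₁ ω₂ => F (Fin.cons c.1 ω₁) (Fin.cons c.2 ω₂)).sum

/-- The first copy: `σ` on the free edges, the pinned state elsewhere. -/
def mix {n : ℕ} (s : Fin n → Fin 3) (σ : Fin n → Bool) : Fin n → Bool :=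
  fun x => if s x = 2 then σ x else decide (s x = 1)

/-- The second copy: `!σ` on the free edges, the pinned state elsewhere. -/
def mix' {n : ℕ} (s : Fin n → Fin 3) (σ : Fin n → Bool) : Fin n → Bool :=
  fun x => if s x = 2 then !σ x else decide (s x = 1)

/-- Every element of `Fin 3` is `0`, `1` or `2`. -/
lemma fin3_cases (x : Fin 3) : x = 0 ∨ x = 1 ∨ x = 2 := by
  fin_cases x <;> simp

/-- A sum over `Fin (n+1) → Bool` splits along the first coordinate. -/
lemma sum_pi_succ (n : ℕ) (g : (Fin (n + 1) → Bool) → ℤ) :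
    ∑ ω, g ω = ∑ b : Bool, ∑ ω : Fin n → Bool, g (Fin.cons b ω) := by
  rw [← Equiv.sum_comp (Fin.consEquiv fun _ => Bool) g, Fintype.sum_prod_type]
  rfl

/-- `mix` at a pattern with first state `2`. -/
lemma mix_cons_two {n : ℕ} (s : Fin (n + 1) → Fin 3) (h : s 0 = 2) (b : Bool)
    (σ : Fin n → Bool) : mix s (Fin.cons b σ) = Fin.cons b (mix (Fin.tail s) σ) := by
  funext x
  refine Fin.cases ?_ (fun i => ?_) x
  · simp [mix, h]
  · show (if s i.succ = 2 then (Fin.cons b σ : Fin (n + 1) → Bool) i.succ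
      else decide (s i.succ = 1)) = mix (Fin.tail s) σ i
    rw [Fin.cons_succ]; rfl

/-- `mix'` at a pattern with first state `2`. -/
lemma mix'_cons_two {n : ℕ} (s : Fin (n + 1) → Fin 3) (h : s 0 = 2) (b : Bool)
    (σ : Fin n → Bool) : mix' s (Fin.cons b σ) = Fin.cons (!b) (mix' (Fin.tail s) σ) := by
  funext x
  refine Fin.cases ?_ (fun i => ?_) x
  · simp [mix', h]
  · show (if s i.succ = 2 then !(Fin.cons b σ : Fin (n + 1) → Bool) i.succ
      else decide (s i.succ = 1)) = mix' (Fin.tail s) σ i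
    rw [Fin.cons_succ]; rfl

/-- `mix` at a pattern with first state `0` or `1`: the first coordinate is the pinned state. -/
lemma mix_cons_pin {n : ℕ} (s : Fin (n + 1) → Fin 3) (h : s 0 ≠ 2) (b : Bool)
    (σ : Fin n → Bool) :
    mix s (Fin.cons b σ) = Fin.cons (decide (s 0 = 1)) (mix (Fin.tail s) σ) := by
  funext x
  refine Fin.cases ?_ (fun i => ?_) x
  · simp [mix, h]
  · show (if s i.succ = 2 then (Fin.cons b σ : Fin (n + 1) → Bool) i.succ
      else decide (s i.succ = 1)) = mix (Fin.tail s) σ i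
    rw [Fin.cons_succ]; rfl

/-- `mix'` at a pattern with first state `0` or `1`. -/
lemma mix'_cons_pin {n : ℕ} (s : Fin (n + 1) → Fin 3) (h : s 0 ≠ 2) (b : Bool)
    (σ : Fin n → Bool) :
    mix' s (Fin.cons b σ) = Fin.cons (decide (s 0 = 1)) (mix' (Fin.tail s) σ) := by
  funext x
  refine Fin.cases ?_ (fun i => ?_) x
  · simp [mix', h]
  · show (if s i.succ = 2 then !(Fin.cons b σ : Fin (n + 1) → Bool) i.succ
      else decide (s i.succ = 1)) = mix' (Fin.tail s) σ i
    rw [Fin.cons_succ]; rfl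

/-- Support in the free edges, split along the first coordinate. -/
lemma supp_cons {n : ℕ} (s : Fin (n + 1) → Fin 3) (b : Bool) (σ : Fin n → Bool) :
    (∀ x, (Fin.cons b σ : Fin (n + 1) → Bool) x = true → s x = 2) ↔
      (b = true → s 0 = 2) ∧ ∀ i, σ i = true → Fin.tail s i = 2 := by
  rw [Fin.forall_fin_succ]
  simp [Fin.tail]

/-- **The nested sum is the filtered sum over all configurations.** -/
theorem kbGen_eq_sum (n : ℕ) (s : Fin n → Fin 3) (F : (Fin n → Bool) → (Fin n → Bool) → ℤ) :
    kbGen n s F =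
      ∑ σ : Fin n → Bool, if (∀ x, σ x = true → s x = 2) then F (mix s σ) (mix' s σ) else 0 := by
  induction n with
  | zero =>
    rw [Fintype.sum_unique]
    simp only [IsEmpty.forall_iff, if_true]
    unfold kbGen
    congr 1 <;> exact Subsingleton.elim _ _
  | succ n ih =>
    rw [sum_pi_succ, Fintype.sum_bool]
    rcases fin3_cases (s 0) with h0 | h0 | h0
    · -- closed: only `b = false` contributes
      have hne : s 0 ≠ 2 := by rw [h0]; decide
      have hb1 : ∀ σ : Fin n → Bool, (if (∀ x, (Fin.cons true σ : Fin (n + 1) → Bool) x = true → s x = 2) then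
          F (mix s (Fin.cons true σ)) (mix' s (Fin.cons true σ)) else 0) = 0 := by
        intro σ
        rw [if_neg]
        rw [supp_cons]
        rintro ⟨h, -⟩
        exact hne (h rfl)
      simp only [hb1, sum_const_zero, zero_add]
      unfold kbGen
      rw [h0]
      simp only [choices, List.map_cons, List.map_nil, List.sum_cons, List.sum_nil, add_zero]
      rw [ih]
      refine sum_congr rfl fun σ _ => if_congr ?_ ?_ rfl
      · rw [supp_cons]; simp
      · rw [mix_cons_pin s hne, mix'_cons_pin s hne, h0]; simp
    · -- open: only `b = false` contributes, with the first coordinate `true` in both copies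
      have hne : s 0 ≠ 2 := by rw [h0]; decide
      have hb1 : ∀ σ : Fin n → Bool, (if (∀ x, (Fin.cons true σ : Fin (n + 1) → Bool) x = true → s x = 2) then
          F (mix s (Fin.cons true σ)) (mix' s (Fin.cons true σ)) else 0) = 0 := by
        intro σ
        rw [if_neg]
        rw [supp_cons]
        rintro ⟨h, -⟩
        exact hne (h rfl)
      simp only [hb1, sum_const_zero, zero_add]
      unfold kbGen
      rw [h0]
      simp only [choices, List.map_cons, List.map_nil, List.sum_cons, List.sum_nil, add_zero]
      rw [ih]
      refine sum_congr rfl fun σ _ => if_congr ?_ ?_ rfl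
      · rw [supp_cons]; simp
      · rw [mix_cons_pin s hne, mix'_cons_pin s hne, h0]; simp
    · -- free: both branches
      unfold kbGen
      rw [h0]
      simp only [choices, List.map_cons, List.map_nil, List.sum_cons, List.sum_nil, add_zero]
      rw [ih, ih, add_comm]
      congr 1
      · refine sum_congr rfl fun σ _ => if_congr ?_ ?_ rfl
        · rw [supp_cons]; simp [h0]
        · rw [mix_cons_two s h0, mix'_cons_two s h0]; simp
      · refine sum_congr rfl fun σ _ => if_congr ?_ ?_ rfl
        · rw [supp_cons]; simp [h0]
        · rw [mix_cons_two s h0, mix'_cons_two s h0]; simp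

end Enum

section Bridge

variable {R : Type*} [Field R] [DecidableEq R]

/-- The pinning pattern of a base case `(D, a)`: free on `D`, the state `decide (a x = 1)` off `D`. -/
def stateOf {n : ℕ} (D : Finset (Fin n)) (a : Fin n → R) : Fin n → Fin 3 :=
  fun x => if x ∈ D then 2 else if a x = 1 then 1 else 0

/-- The leaf `1_Q(ω₁) (1_U(ω₁) − 1_U(ω₂)) (1_e(ω₁) − 1_e(ω₂))` for events decided by `q u v`. -/
def termOf {n : ℕ} (q u v : (Fin n → Bool) → Bool) (ω₁ ω₂ : Fin n → Bool) : ℤ :=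
  (if q ω₁ then 1 else 0) * ((if u ω₁ then 1 else 0) - (if u ω₂ then 1 else 0))
    * ((if v ω₁ then 1 else 0) - (if v ω₂ then 1 else 0))

/-- `mix (stateOf D a) σ` is `TReductionBase.baseConfig a D σ`. -/
lemma mix_stateOf {n : ℕ} (D : Finset (Fin n)) (a : Fin n → R) (σ : Fin n → Bool) :
    mix (stateOf D a) σ = baseConfig a D σ := by
  funext x
  unfold mix stateOf baseConfig
  by_cases hx : x ∈ D
  · simp [hx]
  · by_cases ha : a x = 1 <;> simp [hx, ha]

/-- `mix' (stateOf D a) σ` is `TReductionBase.baseConfig a D (!σ)`. -/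
lemma mix'_stateOf {n : ℕ} (D : Finset (Fin n)) (a : Fin n → R) (σ : Fin n → Bool) :
    mix' (stateOf D a) σ = baseConfig a D fun x => !σ x := by
  funext x
  unfold mix' stateOf baseConfig
  by_cases hx : x ∈ D
  · simp [hx]
  · by_cases ha : a x = 1 <;> simp [hx, ha]

/-- Support in the free edges of `stateOf D a` is support on `D`. -/
lemma supp_stateOf {n : ℕ} (D : Finset (Fin n)) (a : Fin n → R) (σ : Fin n → Bool) :
    (∀ x, σ x = true → stateOf D a x = 2) ↔ σ ∈ suppOn D := by
  rw [mem_suppOn]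
  constructor
  · intro h x hx
    by_contra hσ
    have h2 := h x (by simpa using hσ)
    unfold stateOf at h2
    rw [if_neg hx] at h2
    split_ifs at h2 <;> exact absurd h2 (by decide)
  · intro h x hσ
    unfold stateOf
    by_cases hx : x ∈ D
    · rw [if_pos hx]
    · exact absurd (h x hx) (by rw [hσ]; decide)

omit [DecidableEq R] in
/-- An indicator of an event decided by `q` is the `if` on `q`. -/
lemma indicator_eq_if {n : ℕ} (A : Set (Fin n → Bool)) (q : (Fin n → Bool) → Bool)
    (hA : ∀ ω, ω ∈ A ↔ q ω = true) (ω : Fin n → Bool) :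
    A.indicator (fun _ => (1 : R)) ω = if q ω then 1 else 0 := by
  by_cases h : ω ∈ A
  · rw [Set.indicator_of_mem h, if_pos ((hA ω).1 h)]
  · rw [Set.indicator_of_notMem h, if_neg (fun hq => h ((hA ω).2 hq))]

/-- **The base case of `kform` is the nested sum**, for events decided by Boolean predicates. -/
theorem kform_eq_kbGen {n : ℕ} (Q U e : Set (Fin n → Bool)) (q u v : (Fin n → Bool) → Bool)
    (hQ : ∀ ω, ω ∈ Q ↔ q ω = true) (hU : ∀ ω, ω ∈ U ↔ u ω = true)
    (he : ∀ ω, ω ∈ e ↔ v ω = true) (D : Finset (Fin n)) (a : Fin n → R)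
    (ha : ∀ x, x ∉ D → a x = 0 ∨ a x = 1) :
    kform Q U e D a = ((kbGen n (stateOf D a) (termOf q u v) : ℤ) : R) := by
  have hf : (univ.filter fun σ : Fin n → Bool => ∀ x, σ x = true → stateOf D a x = 2) = suppOn D := by
    ext σ
    rw [mem_filter, supp_stateOf]
    simp
  rw [kform_eq_antipodal_sum Q U e ha, kbGen_eq_sum, ← sum_filter, hf, Int.cast_sum]
  refine sum_congr rfl fun σ _ => ?_
  rw [termOf, mix_stateOf, mix'_stateOf, indicator_eq_if Q q hQ, indicator_eq_if U u hU,
    indicator_eq_if U u hU, indicator_eq_if e v he, indicator_eq_if e v he]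
  push_cast
  rfl

end Bridge

end THBaseEnum

end Summit.Ventures.PercRepro2
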